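import Literature.Probability.LatticeModels.TransferOperator
import Literature.Analysis.UnboundedOperators.SpectralGapProofs
import Mathlib

/-!
# Proof of `WeakPoincareDecay` (card `two-slice-weak-poincare`, crux stmt-QuantumFields-9442)

Discrete Röckner–Wang: a weak Poincaré inequality for the transfer form `‖v‖² − re⟪Tv,v⟫` of a
positive contraction `T` (tree `TransferData`) gives polynomial decay of `re⟪Tⁿv,v⟫` for vectors
orthogonal to the vacuum. Statement copied verbatim from `Sketch.lean`.
-/

noncomputable section

namespace Summit.QuantumFields.YangMills.Cruxes.FiniteSusceptibilityWeakCoupling.Sketch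

open scoped InnerProductSpace
open Literature.Probability.LatticeModels RCLike Real Filter Topology

/-- Verbatim copy of the statement in `Sketch.lean`. -/
def WeakPoincareDecay : Prop :=
  ∀ (H : Type) [NormedAddCommGroup H] [InnerProductSpace ℂ H] [CompleteSpace H]
    (D : TransferData H) (Φ : H → ℝ) (C p : ℝ), 0 < C → 0 < p →
    (∀ v, 0 ≤ Φ v) → (∀ v, Φ (D.T v) ≤ Φ v) →
    (∀ v : H, ⟪D.vacuum, v⟫_ℂ = 0 → ∀ s : ℝ, 0 < s →
        ‖v‖ ^ 2 ≤ C * s ^ (-p) * (‖v‖ ^ 2 - RCLike.re ⟪D.T v, v⟫_ℂ) + s * Φ v) →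
    ∀ q : ℝ, 0 < q → q < 1 / p → ∃ C' : ℝ, ∀ v : H, ⟪D.vacuum, v⟫_ℂ = 0 → ∀ n : ℕ,
        RCLike.re ⟪(D.T ^ n) v, v⟫_ℂ ≤ C' * ((n : ℝ) + 1) ^ (-q) * (‖v‖ ^ 2 + Φ v)

section Lemmas

variable {H : Type} [NormedAddCommGroup H] [InnerProductSpace ℂ H] [CompleteSpace H]
  (D : TransferData H)

/-- `‖T w‖² ≤ re ⟪T w, w⟫` for the positive contraction `T`. [folklore] -/
theorem norm_apply_sq_le_re_inner (w : H) : ‖D.T w‖ ^ 2 ≤ re ⟪D.T w, w⟫_ℂ := by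
  have h := D.isPositive.norm_apply_sq_le w
  have h0 : 0 ≤ re ⟪D.T w, w⟫_ℂ := D.isPositive.re_inner_nonneg_left w
  calc ‖D.T w‖ ^ 2 ≤ ‖D.T‖ * re ⟪D.T w, w⟫_ℂ := h
    _ ≤ 1 * re ⟪D.T w, w⟫_ℂ := by gcongr; exact D.norm_le_one
    _ = re ⟪D.T w, w⟫_ℂ := one_mul _

/-- Powers of `T` preserve orthogonality to the vacuum. [folklore] -/
theorem inner_vacuum_pow_eq_zero {v : H} (hv : ⟪D.vacuum, v⟫_ℂ = 0) (k : ℕ) :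
    ⟪D.vacuum, (D.T ^ k) v⟫_ℂ = 0 := by
  have hsym : ∀ x y : H, ⟪D.T x, y⟫_ℂ = ⟪x, D.T y⟫_ℂ := fun x y => by
    simpa using D.isPositive.isSelfAdjoint.isSymmetric x y
  induction k with
  | zero => simpa using hv
  | succ k ih =>
    rw [pow_succ' D.T k, ContinuousLinearMap.mul_apply, ← hsym, D.map_vacuum]
    exact ih

/-- `Φ` decreases along the orbit. [folklore] -/
theorem phi_pow_le {Φ : H → ℝ} (hΦT : ∀ v, Φ (D.T v) ≤ Φ v) (v : H) (k : ℕ) :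
    Φ ((D.T ^ k) v) ≤ Φ v := by
  induction k with
  | zero => simp
  | succ k ih =>
    rw [pow_succ' D.T k, ContinuousLinearMap.mul_apply]
    exact (hΦT _).trans ih

/-- One step: the weak Poincaré inequality gives a contraction of `‖T w‖²` up to the `Φ`-term.
[folklore] -/
theorem one_step {Φ : H → ℝ} {C p : ℝ} (hC : 0 < C)
    (hWPI : ∀ v : H, ⟪D.vacuum, v⟫_ℂ = 0 → ∀ s : ℝ, 0 < s →
        ‖v‖ ^ 2 ≤ C * s ^ (-p) * (‖v‖ ^ 2 - re ⟪D.T v, v⟫_ℂ) + s * Φ v)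
    {w : H} (hw : ⟪D.vacuum, w⟫_ℂ = 0) {s : ℝ} (hs : 0 < s) :
    ‖D.T w‖ ^ 2 ≤ (1 - s ^ p / C) * ‖w‖ ^ 2 + s * (s ^ p / C) * Φ w := by
  have h := hWPI w hw s hs
  have hsp : 0 < s ^ p := Real.rpow_pos_of_pos hs p
  have hspC : 0 < s ^ p / C := div_pos hsp hC
  -- multiply the WPI by s^p / C
  have h2 : s ^ p / C * ‖w‖ ^ 2 ≤ (‖w‖ ^ 2 - re ⟪D.T w, w⟫_ℂ) + s * (s ^ p / C) * Φ w := by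
    have := mul_le_mul_of_nonneg_left h hspC.le
    have hcancel : s ^ p / C * (C * s ^ (-p) * (‖w‖ ^ 2 - re ⟪D.T w, w⟫_ℂ)) =
        ‖w‖ ^ 2 - re ⟪D.T w, w⟫_ℂ := by
      rw [Real.rpow_neg hs.le]
      field_simp
    calc s ^ p / C * ‖w‖ ^ 2
        ≤ s ^ p / C * (C * s ^ (-p) * (‖w‖ ^ 2 - re ⟪D.T w, w⟫_ℂ) + s * Φ w) := this
      _ = (‖w‖ ^ 2 - re ⟪D.T w, w⟫_ℂ) + s * (s ^ p / C) * Φ w := by rw [mul_add, hcancel]; ring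
  have h3 := norm_apply_sq_le_re_inner D w
  linarith

/-- Iteration: `‖Tᵏ v‖² ≤ (1 - θ)ᵏ ‖v‖² + s Φ v`, `θ = sᵖ/C ≤ 1`. [folklore] -/
theorem iterate_bound {Φ : H → ℝ} {C p : ℝ} (hC : 0 < C) (hΦ0 : ∀ v, 0 ≤ Φ v)
    (hΦT : ∀ v, Φ (D.T v) ≤ Φ v)
    (hWPI : ∀ v : H, ⟪D.vacuum, v⟫_ℂ = 0 → ∀ s : ℝ, 0 < s →
        ‖v‖ ^ 2 ≤ C * s ^ (-p) * (‖v‖ ^ 2 - re ⟪D.T v, v⟫_ℂ) + s * Φ v)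
    {v : H} (hv : ⟪D.vacuum, v⟫_ℂ = 0) {s : ℝ} (hs : 0 < s) (hsC : s ^ p / C ≤ 1) (k : ℕ) :
    ‖(D.T ^ k) v‖ ^ 2 ≤ (1 - s ^ p / C) ^ k * ‖v‖ ^ 2 + s * Φ v := by
  induction k with
  | zero =>
    have : 0 ≤ s * Φ v := mul_nonneg hs.le (hΦ0 v)
    simpa using this
  | succ k ih =>
    have hθ0 : 0 ≤ 1 - s ^ p / C := sub_nonneg.mpr hsC
    have hθ1 : 0 ≤ s ^ p / C := div_nonneg (Real.rpow_nonneg hs.le p) hC.le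
    have hstep := one_step D hC hWPI (inner_vacuum_pow_eq_zero D hv k) hs (Φ := Φ) (p := p)
    have hΦk := phi_pow_le D hΦT v k
    rw [pow_succ' D.T k, ContinuousLinearMap.mul_apply]
    calc ‖D.T ((D.T ^ k) v)‖ ^ 2
        ≤ (1 - s ^ p / C) * ‖(D.T ^ k) v‖ ^ 2 + s * (s ^ p / C) * Φ ((D.T ^ k) v) := hstep
      _ ≤ (1 - s ^ p / C) * ((1 - s ^ p / C) ^ k * ‖v‖ ^ 2 + s * Φ v)
            + s * (s ^ p / C) * Φ v := by
          gcongr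
      _ = (1 - s ^ p / C) ^ (k + 1) * ‖v‖ ^ 2 + s * Φ v := by ring

/-- Symmetry of the powers of `T`. [folklore] -/
theorem inner_pow_symm (m : ℕ) (x y : H) : ⟪(D.T ^ m) x, y⟫_ℂ = ⟪x, (D.T ^ m) y⟫_ℂ := by
  have hsym1 : ∀ x y : H, ⟪D.T x, y⟫_ℂ = ⟪x, D.T y⟫_ℂ := fun x y => by
    simpa using D.isPositive.isSelfAdjoint.isSymmetric x y
  induction m generalizing x y with
  | zero => simp
  | succ m ih =>
    have h1 : (D.T ^ (m + 1)) x = D.T ((D.T ^ m) x) := by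
      rw [pow_succ' D.T m, ContinuousLinearMap.mul_apply]
    have h2 : (D.T ^ (m + 1)) y = (D.T ^ m) (D.T y) := by
      rw [pow_succ D.T m, ContinuousLinearMap.mul_apply]
    rw [h1, h2, hsym1, ih]

/-- `re ⟪Tⁿ v, v⟫ ≤ ‖T^{⌊n/2⌋} v‖²`. [folklore] -/
theorem re_inner_pow_le (v : H) (n : ℕ) :
    re ⟪(D.T ^ n) v, v⟫_ℂ ≤ ‖(D.T ^ (n / 2)) v‖ ^ 2 := by
  obtain ⟨m, hm | hm⟩ := Nat.even_or_odd' n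
  · -- n = 2m
    have hdiv : n / 2 = m := by omega
    have hpow : (D.T ^ n) v = (D.T ^ m) ((D.T ^ m) v) := by
      rw [hm, two_mul, pow_add, ContinuousLinearMap.mul_apply]
    rw [hdiv, hpow, inner_pow_symm D m, inner_self_eq_norm_sq (𝕜 := ℂ)]
  · -- n = 2m + 1
    have hdiv : n / 2 = m := by omega
    have hpow : (D.T ^ n) v = (D.T ^ m) (D.T ((D.T ^ m) v)) := by
      have : D.T ^ n = D.T ^ m * (D.T * D.T ^ m) := by
        rw [hm, ← pow_succ', two_mul, add_assoc, pow_add]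
      rw [this, ContinuousLinearMap.mul_apply, ContinuousLinearMap.mul_apply]
    rw [hdiv, hpow, inner_pow_symm D m]
    set w := (D.T ^ m) v
    calc re ⟪D.T w, w⟫_ℂ ≤ ‖D.T w‖ * ‖w‖ := re_inner_le_norm _ _
      _ ≤ 1 * ‖w‖ * ‖w‖ := by
          gcongr
          calc ‖D.T w‖ ≤ ‖D.T‖ * ‖w‖ := D.T.le_opNorm w
            _ ≤ 1 * ‖w‖ := by gcongr; exact D.norm_le_one
      _ = ‖w‖ ^ 2 := by ring

end Lemmas

section Analysis

/-- A stretched exponential beats every power: for `0 < a`, `0 < c`, `0 ≤ q` there is `M ≥ 1` with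
`exp (-(c * x ^ a)) ≤ M * x ^ (-q)` for all `x ≥ 1`. [folklore] -/
theorem exists_exp_neg_rpow_le {a c q : ℝ} (ha : 0 < a) (hc : 0 < c) (hq : 0 ≤ q) :
    ∃ M : ℝ, 1 ≤ M ∧ ∀ x : ℝ, 1 ≤ x → Real.exp (-(c * x ^ a)) ≤ M * x ^ (-q) := by
  have ht : Tendsto (fun y : ℝ => y ^ (q / a) * Real.exp (-c * y)) atTop (𝓝 0) :=
    tendsto_rpow_mul_exp_neg_mul_atTop_nhds_zero (q / a) c hc
  have hev : ∀ᶠ y in atTop, y ^ (q / a) * Real.exp (-c * y) < 1 :=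
    ht.eventually_lt_const zero_lt_one
  obtain ⟨Y, hY⟩ := Filter.eventually_atTop.1 hev
  set Y' : ℝ := max Y 1 with hY'
  have hY'1 : 1 ≤ Y' := le_max_right _ _
  have hqa : 0 ≤ q / a := div_nonneg hq ha.le
  refine ⟨Y' ^ (q / a), Real.one_le_rpow hY'1 hqa, fun x hx => ?_⟩
  have hx0 : 0 < x := by linarith
  set y : ℝ := x ^ a with hy
  have hy1 : 1 ≤ y := Real.one_le_rpow hx ha.le
  have hy0 : 0 < y := by linarith
  have hg : y ^ (q / a) * Real.exp (-c * y) ≤ Y' ^ (q / a) := by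
    by_cases hyY : Y' ≤ y
    · exact (hY y (le_trans (le_max_left _ _) hyY)).le.trans (Real.one_le_rpow hY'1 hqa)
    · push Not at hyY
      have hexp : Real.exp (-c * y) ≤ 1 := Real.exp_le_one_iff.mpr (by nlinarith)
      calc y ^ (q / a) * Real.exp (-c * y) ≤ y ^ (q / a) * 1 := by gcongr
        _ ≤ Y' ^ (q / a) * 1 := by gcongr
        _ = Y' ^ (q / a) := mul_one _
  have hyq : y ^ (-(q / a)) = x ^ (-q) := by
    rw [hy, ← Real.rpow_mul hx0.le]
    congr 1
    field_simp
  have hA : y ^ (q / a) ≠ 0 := ne_of_gt (Real.rpow_pos_of_pos hy0 _)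
  have e1 : Real.exp (-(c * x ^ a)) = Real.exp (-c * y) := by rw [hy, neg_mul]
  rw [e1]
  calc Real.exp (-c * y) = (y ^ (q / a))⁻¹ * (y ^ (q / a) * Real.exp (-c * y)) := by
        rw [inv_mul_cancel_left₀ hA]
    _ ≤ (y ^ (q / a))⁻¹ * Y' ^ (q / a) := by gcongr
    _ = Y' ^ (q / a) * x ^ (-q) := by rw [← Real.rpow_neg hy0.le, hyq, mul_comm]

end Analysis

/-- **`WeakPoincareDecay` holds.** [folklore] -/
theorem weakPoincareDecay_holds : WeakPoincareDecay := by
  intro H _ _ _ D Φ C p hC hp hΦ0 hΦT hWPI q hq hqp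
  -- enlarge the constant to C₁ ≥ 1
  set C₁ : ℝ := max C 1 with hC₁def
  have hC₁ : 0 < C₁ := lt_of_lt_of_le zero_lt_one (le_max_right _ _)
  have h1C₁ : 1 ≤ C₁ := le_max_right _ _
  have hWPI₁ : ∀ v : H, ⟪D.vacuum, v⟫_ℂ = 0 → ∀ s : ℝ, 0 < s →
      ‖v‖ ^ 2 ≤ C₁ * s ^ (-p) * (‖v‖ ^ 2 - re ⟪D.T v, v⟫_ℂ) + s * Φ v := by
    intro v hv s hs
    have h := hWPI v hv s hs
    have hbr : 0 ≤ ‖v‖ ^ 2 - re ⟪D.T v, v⟫_ℂ := by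
      have : re ⟪D.T v, v⟫_ℂ ≤ ‖v‖ ^ 2 :=
        calc re ⟪D.T v, v⟫_ℂ ≤ ‖D.T v‖ * ‖v‖ := re_inner_le_norm _ _
          _ ≤ 1 * ‖v‖ * ‖v‖ := by
              gcongr
              calc ‖D.T v‖ ≤ ‖D.T‖ * ‖v‖ := D.T.le_opNorm v
                _ ≤ 1 * ‖v‖ := by gcongr; exact D.norm_le_one
          _ = ‖v‖ ^ 2 := by ring
      linarith
    have hsp : 0 ≤ s ^ (-p) := Real.rpow_nonneg hs.le _
    calc ‖v‖ ^ 2 ≤ C * s ^ (-p) * (‖v‖ ^ 2 - re ⟪D.T v, v⟫_ℂ) + s * Φ v := h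
      _ ≤ C₁ * s ^ (-p) * (‖v‖ ^ 2 - re ⟪D.T v, v⟫_ℂ) + s * Φ v := by
          gcongr
          exact le_max_left _ _
  -- exponents
  have hpq : p * q < 1 := by
    have := (lt_div_iff₀ hp).1 hqp
    linarith [mul_comm p q]
  set a : ℝ := 1 - p * q with ha_def
  have ha : 0 < a := by linarith
  obtain ⟨M, hM1, hM⟩ := exists_exp_neg_rpow_le (a := a) (c := 1 / (2 * C₁)) (q := q) ha
    (by positivity) hq.le
  refine ⟨(M + 1) * 2 ^ q, fun v hv n => ?_⟩
  set k : ℕ := n / 2 with hk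
  -- the s of step k
  set x : ℝ := (k : ℝ) + 1 with hx
  have hx1 : 1 ≤ x := by rw [hx]; linarith [(Nat.cast_nonneg k : (0 : ℝ) ≤ k)]
  have hx0 : 0 < x := by linarith
  set s : ℝ := x ^ (-q) with hs_def
  have hs : 0 < s := Real.rpow_pos_of_pos hx0 _
  have hsp : s ^ p = x ^ (-(p * q)) := by
    rw [hs_def, ← Real.rpow_mul hx0.le]; congr 1; ring
  have hθle : s ^ p / C₁ ≤ 1 := by
    rw [div_le_one hC₁, hsp]
    exact (Real.rpow_le_one_of_one_le_of_nonpos hx1 (by nlinarith)).trans h1C₁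
  have hθ0 : 0 ≤ s ^ p / C₁ := div_nonneg (Real.rpow_nonneg hs.le _) hC₁.le
  -- steps 1 and 2
  have step1 : re ⟪(D.T ^ n) v, v⟫_ℂ ≤ ‖(D.T ^ k) v‖ ^ 2 := re_inner_pow_le D v n
  have step2 : ‖(D.T ^ k) v‖ ^ 2 ≤ (1 - s ^ p / C₁) ^ k * ‖v‖ ^ 2 + s * Φ v :=
    iterate_bound D hC₁ hΦ0 hΦT hWPI₁ hv hs hθle k
  -- step 3: (1 - θ)^k ≤ exp(-k θ) ≤ M x^(-q)
  have step3 : (1 - s ^ p / C₁) ^ k ≤ M * x ^ (-q) := by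
    have hexp : (1 - s ^ p / C₁) ^ k ≤ Real.exp (-(k * (s ^ p / C₁))) := by
      calc (1 - s ^ p / C₁) ^ k ≤ (Real.exp (-(s ^ p / C₁))) ^ k := by
            gcongr
            exact Real.one_sub_le_exp_neg _
        _ = Real.exp (-(k * (s ^ p / C₁))) := by
            rw [← Real.exp_nat_mul]; congr 1; ring
    rcases Nat.eq_zero_or_pos k with hk0 | hkpos
    · -- k = 0
      have hx1' : x = 1 := by rw [hx, hk0]; simp
      rw [hk0, pow_zero, hx1', Real.one_rpow, mul_one]
      exact hM1
    · -- k ≥ 1 : k θ ≥ x^a / (2 C₁)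
      have hk1 : (1 : ℝ) ≤ k := by exact_mod_cast hkpos
      have hkx : x ≤ 2 * k := by rw [hx]; linarith
      have hxa : x ^ a = x * x ^ (-(p * q)) := by
        rw [ha_def, sub_eq_add_neg, Real.rpow_add hx0, Real.rpow_one]
      have hlow : 1 / (2 * C₁) * x ^ a ≤ k * (s ^ p / C₁) := by
        rw [hsp, hxa]
        have hxpq : 0 ≤ x ^ (-(p * q)) := Real.rpow_nonneg hx0.le _
        rw [div_mul_eq_mul_div, one_mul, div_le_iff₀ (by positivity : (0 : ℝ) < 2 * C₁)]
        calc x * x ^ (-(p * q)) ≤ (2 * k) * x ^ (-(p * q)) := by gcongr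
          _ = k * (x ^ (-(p * q)) / C₁) * (2 * C₁) := by field_simp
      calc (1 - s ^ p / C₁) ^ k ≤ Real.exp (-(k * (s ^ p / C₁))) := hexp
        _ ≤ Real.exp (-(1 / (2 * C₁) * x ^ a)) := by
            rw [Real.exp_le_exp]; linarith
        _ ≤ M * x ^ (-q) := hM x hx1
  -- step 4: x^(-q) ≤ 2^q (n+1)^(-q)
  have step4 : x ^ (-q) ≤ 2 ^ q * ((n : ℝ) + 1) ^ (-q) := by
    have hn0 : (0 : ℝ) < (n : ℝ) + 1 := by positivity
    have hnx : (n : ℝ) + 1 ≤ 2 * x := by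
      rw [hx]
      have : n ≤ 2 * k + 1 := by omega
      have : (n : ℝ) ≤ 2 * k + 1 := by exact_mod_cast this
      linarith
    have h2x : (2 * x) ^ (-q) ≤ ((n : ℝ) + 1) ^ (-q) :=
      Real.rpow_le_rpow_of_nonpos hn0 hnx (by linarith)
    have hsplit : x ^ (-q) = 2 ^ q * (2 * x) ^ (-q) := by
      rw [Real.mul_rpow (by norm_num) hx0.le, Real.rpow_neg (by norm_num : (0:ℝ) ≤ 2), ← mul_assoc,
        mul_inv_cancel₀ (ne_of_gt (Real.rpow_pos_of_pos two_pos q)), one_mul]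
    calc x ^ (-q) = 2 ^ q * (2 * x) ^ (-q) := hsplit
      _ ≤ 2 ^ q * ((n : ℝ) + 1) ^ (-q) := by gcongr
  -- assembly
  have hxq0 : 0 ≤ x ^ (-q) := Real.rpow_nonneg hx0.le _
  have hv2 : 0 ≤ ‖v‖ ^ 2 := sq_nonneg _
  have hΦv : 0 ≤ Φ v := hΦ0 v
  have hM0 : 0 ≤ M := zero_le_one.trans hM1
  calc re ⟪(D.T ^ n) v, v⟫_ℂ ≤ ‖(D.T ^ k) v‖ ^ 2 := step1
    _ ≤ (1 - s ^ p / C₁) ^ k * ‖v‖ ^ 2 + s * Φ v := step2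
    _ ≤ (M * x ^ (-q)) * ‖v‖ ^ 2 + x ^ (-q) * Φ v := by
        gcongr
    _ ≤ (M + 1) * x ^ (-q) * (‖v‖ ^ 2 + Φ v) := by nlinarith [mul_nonneg hxq0 hv2, mul_nonneg hxq0 hΦv, mul_nonneg hM0 (mul_nonneg hxq0 hΦv)]
    _ ≤ (M + 1) * (2 ^ q * ((n : ℝ) + 1) ^ (-q)) * (‖v‖ ^ 2 + Φ v) := by gcongr
    _ = (M + 1) * 2 ^ q * ((n : ℝ) + 1) ^ (-q) * (‖v‖ ^ 2 + Φ v) := by ring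

end Summit.QuantumFields.YangMills.Cruxes.FiniteSusceptibilityWeakCoupling.Sketch
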